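import Summits.HodgeConjecture.HodgeConjecture.Theorems.HodgeLocusCensusPlaneSumRank6
import Summits.HodgeConjecture.HodgeConjecture.Theorems.HodgeLocusCensusPlaneSumCertsA
import Summits.HodgeConjecture.HodgeConjecture.Theorems.HodgeLocusCensusPlaneSumCertsB
import Summits.HodgeConjecture.HodgeConjecture.Theorems.HodgeLocusCensusPlaneSumCertsC
import HarnessLib

/-!
# HodgeLocusCensusPlaneSumCells6 — PROVED: the six plane-sum census rows of the Fermat quartic SIXFOLD (ranks 39, 42, 36, 36, 53, 53) (cell pub-hlocus, LEAD gen 5, (T36))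
HONEST FRAMING: certified instances and evidence bearing on the general Hodge conjecture; no claim.

Corollaries of `ivhsRankEq_of_cert6` (`HodgeLocusCensusPlaneSumRank6`) and the kernel-checked certificates (`HodgeLocusCensusPlaneSumCertsA/B/C`):
the typed rows `explainedSmooth_6_4_scroll` ([Z] − [Π], rank 39), `firstOrder_6_4_zPlusPi` ([Z] + [Π], 42), the twist cells [Z] ∓ [Z′] (36, 36) of
`HodgeLocusCensusTwistCells` and `explainedSmooth_6_4_ZplusPiPrime` / `notAlpha_6_4_ZminusPiPrime` ([Z] ± [Π′], 53, 53) of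
`HodgeLocusCensusGrassmannianCells` HOLD: rank [p_{i+j}(δ)] = r over every field of characteristic 0 and every primitive 8th root of unity.
What is proved is exactly the typed first-order statement (the rank of Movasati's matrix); the census LABELS of these rows (EXPLAINED-SMOOTH /
NOT (α) / OPEN INSTANCE: the geometry of the Hodge locus beyond first order) are records of the cell, not Lean theorems, and are untouched.
-/

namespace Summit.HodgeConjecture.HodgeConjecture.HodgeLocus.Census.PlaneSum

open TwistCells GrSection

/-- the census class `scrollMinus6` on X⁴_6 is the plane list of `scrollL`. -/
theorem scroll_list6 : scrollMinus6 = planeList6 scrollL := by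
  simp [scrollMinus6, planeList6, scrollL]

/-- PROVED ROW: `TwistCells.explainedSmooth_6_4_scroll` — rank [p_{i+j}(δ)] = 39. -/
theorem explainedSmooth_6_4_scroll_holds : TwistCells.explainedSmooth_6_4_scroll := by
  unfold TwistCells.explainedSmooth_6_4_scroll ExplainedSmoothRow
  rw [scroll_list6]
  exact ivhsRankEq_of_cert6 scrollL scrollCert scroll_valid scrollModeK6 scrollOff6 scroll_H1_6 scroll_H2_6 scroll_H3_6

/-- the census class `zPlusPi6` on X⁴_6 is the plane list of `zPlusPiL`. -/
theorem zPlusPi_list6 : zPlusPi6 = planeList6 zPlusPiL := by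
  simp [zPlusPi6, planeList6, zPlusPiL]

/-- PROVED ROW: `TwistCells.firstOrder_6_4_zPlusPi` — rank [p_{i+j}(δ)] = 42. -/
theorem firstOrder_6_4_zPlusPi_holds : TwistCells.firstOrder_6_4_zPlusPi := by
  unfold TwistCells.firstOrder_6_4_zPlusPi
  rw [zPlusPi_list6]
  exact ivhsRankEq_of_cert6 zPlusPiL zPlusPiCert zPlusPi_valid zPlusPiModeK6 zPlusPiOff6 zPlusPi_H1_6 zPlusPi_H2_6 zPlusPi_H3_6

/-- the census class `twistMinus6` on X⁴_6 is the plane list of `twistMinusL`. -/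
theorem twistMinus_list6 : twistMinus6 = planeList6 twistMinusL := by
  simp [twistMinus6, planeList6, twistMinusL]

/-- PROVED ROW: `TwistCells.openInstance_6_4_twistMinus` — rank [p_{i+j}(δ)] = 36. -/
theorem openInstance_6_4_twistMinus_holds : TwistCells.openInstance_6_4_twistMinus := by
  unfold TwistCells.openInstance_6_4_twistMinus
  rw [twistMinus_list6]
  exact ivhsRankEq_of_cert6 twistMinusL twistMinusCert twistMinus_valid twistMinusModeK6 twistMinusOff6 twistMinus_H1_6 twistMinus_H2_6 twistMinus_H3_6

/-- the census class `twistPlus6` on X⁴_6 is the plane list of `twistPlusL`. -/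
theorem twistPlus_list6 : twistPlus6 = planeList6 twistPlusL := by
  simp [twistPlus6, planeList6, twistPlusL]

/-- PROVED ROW: `TwistCells.openInstance_6_4_twistPlus` — rank [p_{i+j}(δ)] = 36. -/
theorem openInstance_6_4_twistPlus_holds : TwistCells.openInstance_6_4_twistPlus := by
  unfold TwistCells.openInstance_6_4_twistPlus
  rw [twistPlus_list6]
  exact ivhsRankEq_of_cert6 twistPlusL twistPlusCert twistPlus_valid twistPlusModeK6 twistPlusOff6 twistPlus_H1_6 twistPlus_H2_6 twistPlus_H3_6

/-- the census class `explainedSmooth_6_4_ZplusPiPrime` on X⁴_6 is the plane list of `zPlusPiPrimeL`. -/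
theorem zPlusPiPrime_list6 : [(1, plane64 0 0 0 0), (1, plane64 0 2 0 0), (1, plane64 3 0 0 0), (1, plane64 3 2 0 0), (1, plane64 0 0 1 0)] = planeList6 zPlusPiPrimeL := by
  simp [planeList6, zPlusPiPrimeL]

/-- PROVED ROW: `GrSection.explainedSmooth_6_4_ZplusPiPrime` — rank [p_{i+j}(δ)] = 53. -/
theorem explainedSmooth_6_4_ZplusPiPrime_holds : GrSection.explainedSmooth_6_4_ZplusPiPrime := by
  unfold GrSection.explainedSmooth_6_4_ZplusPiPrime ExplainedSmoothRow
  rw [zPlusPiPrime_list6]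
  exact ivhsRankEq_of_cert6 zPlusPiPrimeL zPlusPiPrimeCert zPlusPiPrime_valid zPlusPiPrimeModeK6 zPlusPiPrimeOff6 zPlusPiPrime_H1_6 zPlusPiPrime_H2_6 zPlusPiPrime_H3_6

/-- the census class `notAlpha_6_4_ZminusPiPrime` on X⁴_6 is the plane list of `zMinusPiPrimeL`. -/
theorem zMinusPiPrime_list6 : [(1, plane64 0 0 0 0), (1, plane64 0 2 0 0), (1, plane64 3 0 0 0), (1, plane64 3 2 0 0), (-1, plane64 0 0 1 0)] = planeList6 zMinusPiPrimeL := by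
  simp [planeList6, zMinusPiPrimeL]

/-- PROVED ROW: `GrSection.notAlpha_6_4_ZminusPiPrime` — rank [p_{i+j}(δ)] = 53. -/
theorem notAlpha_6_4_ZminusPiPrime_holds : GrSection.notAlpha_6_4_ZminusPiPrime := by
  unfold GrSection.notAlpha_6_4_ZminusPiPrime
  rw [zMinusPiPrime_list6]
  exact ivhsRankEq_of_cert6 zMinusPiPrimeL zMinusPiPrimeCert zMinusPiPrime_valid zMinusPiPrimeModeK6 zMinusPiPrimeOff6 zMinusPiPrime_H1_6 zMinusPiPrime_H2_6 zMinusPiPrime_H3_6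

end Summit.HodgeConjecture.HodgeConjecture.HodgeLocus.Census.PlaneSum
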